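import Summits.KontsevichZagierPeriods.KontsevichZagierPeriods.Theses.LatticeLefschetz
import Literature.NumberTheory.Transcendental.KZNoriSymbol
import Literature.AlgebraicGeometry.Motives.ClassicalPeriodDatumKernel

/-!
# Crux `OffCellKernel` (stmt-KontsevichZagierPeriods-18160) — birth skeleton (`Lines/birth.lean`, BC3)

Route `LatticeLefschetz` ("integrality is the transcendence"), rank-3 crux `OffCellKernel`, the
route's DECLARED, NOT-CLAIMED remainder: every formal `ℤ`-combination `c` of integral
representations with `KZ.eval c = 0` lies in
`H_cell := KZ.relations ⊔ closure (twisted-squares cell relators)`, i.e. Conjecture 1 of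
Kontsevich–Zagier in kernel form for the calculus ENLARGED by the pair differences `[r] − [r']` of
the two product representations of the cell (the abelian surface `E × E′` of two real elliptic
curves and its double twist `E⁻ × E′⁻`, equal values). The deciding theorem `closes` consumes
exactly this together with the cell (`CellAssembly` and its five engine items). The item is
summit-implied and summit-equivalent modulo the cell (refuter/grounder notes of 2026-08-17 on the
item: `KontsevichZagierPeriods → OffCellKernel` is three lines; class open-problem).

The skeleton cuts the remainder along the two seams the tree already owns for Conjecture 1 —
the factorisation `ker eval = Ψ⁻¹(ker ev) ⊆ ker Ψ ⊆ H_cell` of Kontsevich–Zagier 2001 §4.1 /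
Huber–Müller-Stach 2017 §13.1 (tree pattern `KZ.kernel_subset_relations_of_isFaithful`) — run on
Viu-Sos normal forms, so that each layer is a statement of ONE kind of mathematics and the
accessibility layer speaks only about VOLUMES of bounded `ℚ`-semialgebraic bodies:

* `stub_boundedVolumeNormalForm` (real semialgebraic GEOMETRY inside the rules; provable-class,
  size M): every formal combination is congruent modulo `KZ.relations` to a difference
  `[K₁] − [K₂]` of two BOUNDED integrand-`1` representations of one common dimension — Viu-Sos'
  semi-canonical reduction [ViuSos2021, Thm. 1.1; CressonViusos2022, §1] run on a whole
  combination. Tools landed: `KZ.exists_sub_add_mem_relations_sign`,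
  `KZ.exists_boundedVolume_sub_mem_relations` (sign split, region under the graph, grounding,
  monomial compression; applied to an integrand-`1` body it is also the dimension-raising slab),
  packing `KZ.exists_isCompact_of_sub_of_sub_mem_relations`; missing piece: merging finitely many
  bounded bodies of one dimension into one by rule-(2) translations with disjoint images + (1a).
  This stub is SHARED verbatim with the birth skeletons of the sibling remainder cruxes
  `OffGenusOneSectorKernel` (stmt-14449) and `LaurentMoveKernel` — one proof serves all.
* `stub_classicalSymbolInjective` (TRANSCENDENCE, conjecture-grade = Grothendieck–Kontsevich; the
  CONSTRUCTION is part of the claim, nothing is smuggled into an interface): the classical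
  de Rham–Betti period datum over `ℚ` exists as an instance of the tree's hypothesis structures
  (`ClassicalPeriodDatum ℚ` with `KernelData`; HMS 2017 Ch. 3, §11) and carries Nori symbol data
  `Ψ` for KZ representations (`KZ.NoriSymbolData`: HMS draft III Lemma 11.2.3 / Thm. 11.2.4 plus
  "moves are motivic", Rem. 12.1.7) on which the evaluation of effective formal periods is
  injective (`FormalPeriodEvalInjective`, Kontsevich's formal period conjecture, HMS 2017 §13.2;
  Ayoub / Nori: ⟺ Grothendieck's period conjecture for all motives over `ℚ`). For THIS route it
  is exactly where the mixed four-term Gaussian relations among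
  `{Ω(E)Ω(E′), Ω(E)Ω(E′⁻), Ω(E⁻)Ω(E′), Ω(E⁻)Ω(E′⁻)}` — `GPC(E × E′)`, deliberately outside the cell
  (route header, NOT DECOMPOSED YET) — and every other transcendence input live; the barriers
  `kzConjecture_implies_*` bite here and only here. Shared verbatim with the siblings.
* `stub_motivicVolumesAccessibleModCell` (ACCESSIBILITY off the cell, conjecture-grade = HMS 2017
  Rem. 13.1.8 for volumes, read modulo the cell): for every classical period datum with kernel
  data and every Nori symbol data `Ψ`, two bounded integrand-`1` bodies of one dimension with the
  same Nori symbol, `Ψ([K₁] − [K₂]) = 0` — a MOTIVIC identity of volumes — satisfy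
  `[K₁] − [K₂] ∈ H_cell`: the identity is a chain of moves modulo the twisted-squares relators.
  By (Ψ1) (`ev ∘ Ψ = eval`, tree `KZ.eval_eq_of_noriSymbol_eq`) this stub is implied by the crux in
  every model of the interfaces, so it is never stronger than the crux; it is the crux with the
  transcendence theory and the unbounded/signed-integrand bookkeeping removed. The cell's own
  relators are motivic identities (Lefschetz (1,1) on the real abelian surface `E × E′`: the
  lattice inclusion `μ·iΛ ⊆ Λ′` is an algebraic correspondence), so `closure (cell) ≤ ker Ψ` in the
  intended model and nothing of the cell is asked twice.

Composition (`offCellKernel_of_stubs`, a real proof, ≈ 15 lines; the registered theorem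
`OffCellKernel_of : OffCellKernel` feeds the three stubs in BY NAME): given `c` with `eval c = 0`,
normalise `c ≡ [K₁] − [K₂] (mod relations)`; soundness of the moves
(`KZ.relations_le_ker_eval_holds`) gives `vol K₁ = vol K₂`, i.e. `eval ([K₁] − [K₂]) = 0`; on the
datum of `stub_classicalSymbolInjective`, (Ψ1) turns this into `ev (Ψ([K₁] − [K₂])) = 0` and
injectivity into `Ψ([K₁] − [K₂]) = 0`; accessibility gives `[K₁] − [K₂] ∈ H_cell`; and
`relations ≤ H_cell` climbs back to `c ∈ H_cell`.

BC3 probes (registrar folder `bc/probe_*.lean`): for each stub, `stub → OffCellKernel` and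
`stub → KontsevichZagierPeriods` by `exact?`, `simpa`, `simpa [defs]`, `aesop` all FAIL (normal
form has no kernel content; the datum stub has no accessibility content; accessibility needs a
datum on which `Ψ y = 0` follows from `eval y = 0`). Disproof used: none on record
(`ledger crux ls stmt-KontsevichZagierPeriods-18160`: no workfiles before this one, 2026-08-17;
negatives index of the summit: one entry, KinematicPlaneConvex via `K = ∅`, unrelated — the stubs
are checked on degenerate data: `c = 0 ↦ K₁ = K₂`, `K₁ = K₂ ↦ 0 ∈ H_cell`, empty bodies allowed).
Sorries live ONLY in the three `stub_*` theorems.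
-/

noncomputable section

set_option linter.dupNamespace false

open Literature.NumberTheory.Transcendental
open Literature.AlgebraicGeometry.Motives (ClassicalPeriodDatum)
open Summit.KontsevichZagierPeriods.KontsevichZagierPeriods.Theses.LatticeLefschetz (OffCellKernel)

namespace Summit.KontsevichZagierPeriods.KontsevichZagierPeriods.Cruxes.OffCellKernel.Birth

/-! ### Registered stubs -/

/-- **STUB N — `boundedVolumeNormalForm` (geometry inside the rules; provable-class, size M).**
Every formal `ℤ`-combination of integral representations is congruent, modulo `KZ.relations`, to a
difference `[K₁] − [K₂]` of two representations of ONE common dimension with BOUNDED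
`ℚ`-semialgebraic domains and integrand `1` on them (two bounded semialgebraic bodies). Plan:
`FreeAbelianGroup` induction; a generator `[r]` is `[A_r] − [B_r]` one dimension up by
`KZ.exists_sub_add_mem_relations_sign` + `KZ.exists_boundedVolume_sub_mem_relations`; dimensions are
equalised by the same lemma applied to integrand-`1` bodies (slab `× [0,1]`, one dimension at a
time); sums are merged by rule-(2) translations with pairwise disjoint bounded images and rule (1a);
negation swaps `K₁` and `K₂`; `c = 0` is `K₁ = K₂`. Shared verbatim with
`Cruxes/OffGenusOneSectorKernel/Lines/birth.lean`. [ViuSos2021 Thm. 1.1; CressonViusos2022 §1;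
KontsevichZagier2001 §1.2 rules (1), (2), (3)] -/
theorem stub_boundedVolumeNormalForm :
    ∀ c : KZ.FormalRep, ∃ (m : ℕ) (K₁ K₂ : KZ.IntegralRep m),
      Bornology.IsBounded K₁.domain ∧ Bornology.IsBounded K₂.domain ∧
      (∀ z ∈ K₁.domain, K₁.integrand z = 1) ∧ (∀ z ∈ K₂.domain, K₂.integrand z = 1) ∧
      c - (KZ.of K₁ - KZ.of K₂) ∈ KZ.relations := by
  sorry

/-- **STUB T — `classicalSymbolInjective` (transcendence; construction + conjecture, GPC-strength).**
There is a classical period datum over `ℚ` with kernel data (the de Rham–Betti cohomology of pairs,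
comparison pairing, connecting morphisms, relative exactness on normal-crossings pairs — HMS 2017
Ch. 3, §11; draft I §3) carrying Nori symbol data `Ψ` for the Kontsevich–Zagier calculus (every
representation has a symbol `(X, D, ω, γ)` with the right period and dimension, and every instance of
the four moves is a formal-period relation: HMS draft III Lemma 11.2.3, Thm. 11.2.4, Rem. 12.1.7) on
which the evaluation `ev : 𝒫̃⁺ → ℂ` of effective formal periods is INJECTIVE (Kontsevich's formal
period conjecture for the classical datum, HMS 2017 Def. 13.1.1 / §13.2; equivalent to
Grothendieck's period conjecture for Nori motives over `ℚ`). On route LatticeLefschetz this is where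
`GPC(E × E′)` (the mixed four-term Gaussian-integer Möbius relations, outside the cell) lives. Why it
might fail: only if periods of `ℚ`-varieties satisfy a non-motivic algebraic relation (no candidate
is known), or — for the construction half — if some KZ move is not a formal-period relation (HMS
Rem. 12.1.7, believed). Shared verbatim with the sibling remainder cruxes.
[Kontsevich1999 §4; KontsevichZagier2001 §4.1; HuberMullerStach2017 §13; Ayoub2014; Chudnovsky1984] -/
theorem stub_classicalSymbolInjective :
    ∃ 𝒞 : ClassicalPeriodDatum ℚ, 𝒞.KernelData ∧ Nonempty (𝒞.NoriSymbolData (Rat.castHom ℂ)) ∧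
      FormalPeriodEvalInjective 𝒞.R 𝒞.B (Rat.castHom ℂ) := by
  sorry

/-- **STUB A — `motivicVolumesAccessibleModCell` (accessibility off the twisted-squares cell;
conjecture-grade, HMS 2017 Rem. 13.1.8 for bounded volumes, modulo the cell).** For every classical
period datum over `ℚ` with kernel data and every Nori symbol data `Ψ` on it: if two bounded
integrand-`1` representations `K₁`, `K₂` of one dimension have the same Nori symbol,
`Ψ([K₁] − [K₂]) = 0` in the effective formal periods (a MOTIVIC identity between the volumes of two
bounded `ℚ`-semialgebraic bodies), then `[K₁] − [K₂]` lies in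
`KZ.relations ⊔ closure (twisted-squares cell relators)` — the identity is a finite chain of moves
modulo the pair differences `[r] − [r']` of the cell (verbatim the subgroup of the crux: `r`, `r'`
the product representations over `{x³+Ax+B>0} × {y³+A′y+B′>0}` and `{x³+Ax−B>0} × {y³+A′y−B′>0}`
with integrands `a/√(PP′)`, `b/√(P⁻P′⁻)`, `a, b` positive rationals, equal values). Implied by the
crux in every model (Ψ1: `Ψ y = 0 ⇒ eval y = 0`, tree `KZ.eval_eq_of_noriSymbol_eq`); the cell's
relators are themselves motivic (Lefschetz (1,1) on `E × E′`), so they cost nothing here. Why it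
might fail: one motivic volume identity — an isogeny/correspondence period relation in Hodge level
≥ 2 off the twisted-squares family (the K3 row, a genus-2 Jacobian), a cusp/B-period identity —
with no chain of absolutely convergent real moves even modulo the cell.
[HuberMullerStach2017 Rem. 13.1.8; KontsevichZagier2001 §1.2; CressonViusos2022 §1] -/
theorem stub_motivicVolumesAccessibleModCell :
    ∀ 𝒞 : ClassicalPeriodDatum ℚ, 𝒞.KernelData →
      ∀ (Ψ : 𝒞.NoriSymbolData (Rat.castHom ℂ)) (m : ℕ) (K₁ K₂ : KZ.IntegralRep m),
        Bornology.IsBounded K₁.domain → Bornology.IsBounded K₂.domain →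
        (∀ z ∈ K₁.domain, K₁.integrand z = 1) → (∀ z ∈ K₂.domain, K₂.integrand z = 1) →
        KZ.noriSymbol Ψ (KZ.of K₁ - KZ.of K₂) = 0 →
        KZ.of K₁ - KZ.of K₂ ∈ KZ.relations ⊔ AddSubgroup.closure {d : KZ.FormalRep | ∃ (A B A' B' : ℤ) (a b : ℚ) (r r' : KZ.IntegralRep 2), 4 * A ^ 3 + 27 * B ^ 2 < 0 ∧ 4 * A' ^ 3 + 27 * B' ^ 2 < 0 ∧ 0 < a ∧ 0 < b ∧ r.domain = {x | 0 < x 0 ^ 3 + (A : ℝ) * x 0 + (B : ℝ) ∧ 0 < x 1 ^ 3 + (A' : ℝ) * x 1 + (B' : ℝ)} ∧ Set.EqOn r.integrand (fun x => (a : ℝ) / (Real.sqrt (x 0 ^ 3 + (A : ℝ) * x 0 + (B : ℝ)) * Real.sqrt (x 1 ^ 3 + (A' : ℝ) * x 1 + (B' : ℝ)))) r.domain ∧ r'.domain = {x | 0 < x 0 ^ 3 + (A : ℝ) * x 0 - (B : ℝ) ∧ 0 < x 1 ^ 3 + (A' : ℝ) * x 1 - (B' : ℝ)} ∧ Set.EqOn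 r'.integrand (fun x => (b : ℝ) / (Real.sqrt (x 0 ^ 3 + (A : ℝ) * x 0 - (B : ℝ)) * Real.sqrt (x 1 ^ 3 + (A' : ℝ) * x 1 - (B' : ℝ)))) r'.domain ∧ r.value = r'.value ∧ d = KZ.of r - KZ.of r'} := by
  sorry

/-! ### Composition (no `sorry` below this line) -/

/-- **(Ψ1) + injectivity of `ev`: numerical relations are motivic.** On a classical period datum
carrying Nori symbol data `Ψ` with `ev` injective on the effective formal periods, a formal
combination of integral representations with value `0` has Nori symbol `0`:
`eval y = 0 ⇒ ev (Ψ y) = 0 ⇒ Ψ y = 0` (Kontsevich–Zagier 2001 §4.1; Huber–Müller-Stach 2017 §13.1;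
the first half of `KZ.kernel_subset_relations_of_isFaithful`). Sorry-free helper of the composition.
[folklore] -/
theorem noriSymbol_eq_zero_of_eval_eq_zero (𝒞 : ClassicalPeriodDatum ℚ)
    (Ψ : 𝒞.NoriSymbolData (Rat.castHom ℂ))
    (hinj : FormalPeriodEvalInjective 𝒞.R 𝒞.B (Rat.castHom ℂ)) {y : KZ.FormalRep}
    (hy : KZ.eval y = 0) : KZ.noriSymbol Ψ y = 0 := by
  have h1 : Literature.AlgebraicGeometry.Motives.AlongHom.equiv (Rat.castHom ℂ)
      (formalPeriodEval 𝒞.R (Rat.castHom ℂ) (Ψ.symbol y)) = 0 := by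
    rw [Ψ.eval_symbol y, hy]
    simp
  have h2 : formalPeriodEval 𝒞.R (Rat.castHom ℂ) (Ψ.symbol y) = 0 := by simpa using h1
  rw [KZ.noriSymbol_apply, Submodule.mkQ_apply, Submodule.Quotient.mk_eq_zero]
  exact hinj _ h2

/-- **Composition, hypotheses form (pure logic + soundness of the moves + (Ψ1)).** The three stub
STATEMENTS imply the crux: normalise `c ≡ [K₁] − [K₂]`, read `vol K₁ = vol K₂` off soundness
(`KZ.relations_le_ker_eval_holds`), transport it to `Ψ([K₁] − [K₂]) = 0` on the datum of the
transcendence stub ((Ψ1) `KZ.SymbolMap.eval_symbol` and injectivity of `ev`), apply accessibility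
modulo the cell, and climb back along `KZ.relations ≤ H_cell`. The conclusion is the crux
`OffCellKernel` written out token for token (so that `OffCellKernel_of` below is the unique theorem
of this file concluding the crux BY NAME, as the skeleton audit requires); no `sorry`. [folklore] -/
theorem offCellKernel_of_stubs
    (hN : ∀ c : KZ.FormalRep, ∃ (m : ℕ) (K₁ K₂ : KZ.IntegralRep m),
      Bornology.IsBounded K₁.domain ∧ Bornology.IsBounded K₂.domain ∧
      (∀ z ∈ K₁.domain, K₁.integrand z = 1) ∧ (∀ z ∈ K₂.domain, K₂.integrand z = 1) ∧
      c - (KZ.of K₁ - KZ.of K₂) ∈ KZ.relations)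
    (hT : ∃ 𝒞 : ClassicalPeriodDatum ℚ, 𝒞.KernelData ∧ Nonempty (𝒞.NoriSymbolData (Rat.castHom ℂ)) ∧
      FormalPeriodEvalInjective 𝒞.R 𝒞.B (Rat.castHom ℂ))
    (hA : ∀ 𝒞 : ClassicalPeriodDatum ℚ, 𝒞.KernelData →
      ∀ (Ψ : 𝒞.NoriSymbolData (Rat.castHom ℂ)) (m : ℕ) (K₁ K₂ : KZ.IntegralRep m),
        Bornology.IsBounded K₁.domain → Bornology.IsBounded K₂.domain →
        (∀ z ∈ K₁.domain, K₁.integrand z = 1) → (∀ z ∈ K₂.domain, K₂.integrand z = 1) →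
        KZ.noriSymbol Ψ (KZ.of K₁ - KZ.of K₂) = 0 →
        KZ.of K₁ - KZ.of K₂ ∈ KZ.relations ⊔ AddSubgroup.closure {d : KZ.FormalRep | ∃ (A B A' B' : ℤ) (a b : ℚ) (r r' : KZ.IntegralRep 2), 4 * A ^ 3 + 27 * B ^ 2 < 0 ∧ 4 * A' ^ 3 + 27 * B' ^ 2 < 0 ∧ 0 < a ∧ 0 < b ∧ r.domain = {x | 0 < x 0 ^ 3 + (A : ℝ) * x 0 + (B : ℝ) ∧ 0 < x 1 ^ 3 + (A' : ℝ) * x 1 + (B' : ℝ)} ∧ Set.EqOn r.integrand (fun x => (a : ℝ) / (Real.sqrt (x 0 ^ 3 + (A : ℝ) * x 0 + (B : ℝ)) * Real.sqrt (x 1 ^ 3 + (A' : ℝ) * x 1 + (B' : ℝ)))) r.domain ∧ r'.domain = {x | 0 < x 0 ^ 3 + (A : ℝ) * x 0 - (B : ℝ) ∧ 0 < x 1 ^ 3 + (A' : ℝ) * x 1 - (B' : ℝ)} ∧ Set.EqOn r'.integrand (fun x => (b : ℝ) / (Real.sqrt (x 0 ^ 3 + (A : ℝ) * x 0 - (B :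 ℝ)) * Real.sqrt (x 1 ^ 3 + (A' : ℝ) * x 1 - (B' : ℝ)))) r'.domain ∧ r.value = r'.value ∧ d = KZ.of r - KZ.of r'}) :
    ∀ c : KZ.FormalRep, KZ.eval c = 0 →
      c ∈ KZ.relations ⊔ AddSubgroup.closure {d : KZ.FormalRep | ∃ (A B A' B' : ℤ) (a b : ℚ) (r r' : KZ.IntegralRep 2), 4 * A ^ 3 + 27 * B ^ 2 < 0 ∧ 4 * A' ^ 3 + 27 * B' ^ 2 < 0 ∧ 0 < a ∧ 0 < b ∧ r.domain = {x | 0 < x 0 ^ 3 + (A : ℝ) * x 0 + (B : ℝ) ∧ 0 < x 1 ^ 3 + (A' : ℝ) * x 1 + (B' : ℝ)} ∧ Set.EqOn r.integrand (fun x => (a : ℝ) / (Real.sqrt (x 0 ^ 3 + (A : ℝ) * x 0 + (B : ℝ)) * Real.sqrt (x 1 ^ 3 + (A' : ℝ) * x 1 + (B' : ℝ)))) r.domain ∧ r'.domain = {x | 0 < x 0 ^ 3 + (A : ℝ) * x 0 - (B : ℝ) ∧ 0 < x 1 ^ 3 + (A' : ℝ) * x 1 - (B' : ℝ)} ∧ Set.EqOn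 r'.integrand (fun x => (b : ℝ) / (Real.sqrt (x 0 ^ 3 + (A : ℝ) * x 0 - (B : ℝ)) * Real.sqrt (x 1 ^ 3 + (A' : ℝ) * x 1 - (B' : ℝ)))) r'.domain ∧ r.value = r'.value ∧ d = KZ.of r - KZ.of r'} := by
  intro c hc
  -- Viu-Sos normal form of the whole combination: `c ≡ [K₁] − [K₂]` modulo the moves
  obtain ⟨m, K₁, K₂, h₁b, h₂b, h₁1, h₂1, hcK⟩ := hN c
  -- the classical datum with its Nori symbol, `ev` injective on its effective formal periods
  obtain ⟨𝒞, h𝒞, ⟨Ψ⟩, hinj⟩ := hT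
  -- soundness of the moves: `eval ([K₁] − [K₂]) = eval c = 0`, i.e. `vol K₁ = vol K₂`
  have h0 : KZ.eval (KZ.of K₁ - KZ.of K₂) = 0 := by
    have h : KZ.eval (c - (KZ.of K₁ - KZ.of K₂)) = 0 := KZ.relations_le_ker_eval_holds hcK
    rw [map_sub, hc, zero_sub, neg_eq_zero] at h
    exact h
  -- (Ψ1) + injectivity of `ev`: the identity `vol K₁ = vol K₂` is motivic, `Ψ([K₁] − [K₂]) = 0`
  have hΨ : KZ.noriSymbol Ψ (KZ.of K₁ - KZ.of K₂) = 0 :=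
    noriSymbol_eq_zero_of_eval_eq_zero 𝒞 Ψ hinj h0
  -- accessibility modulo the cell, then climb back along `relations ≤ relations ⊔ closure cell`
  have hsum : c - (KZ.of K₁ - KZ.of K₂) + (KZ.of K₁ - KZ.of K₂) ∈ _ :=
    add_mem (AddSubgroup.mem_sup_left hcK) (hA 𝒞 h𝒞 Ψ m K₁ K₂ h₁b h₂b h₁1 h₂1 hΨ)
  rwa [sub_add_cancel] at hsum

/-- **Skeleton theorem (registered form).** The crux `OffCellKernel` BY NAME from the three
declared stubs, via the sorry-free composition `offCellKernel_of_stubs`; `sorry` occurs only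
inside `stub_boundedVolumeNormalForm`, `stub_classicalSymbolInjective`,
`stub_motivicVolumesAccessibleModCell`. -/
theorem OffCellKernel_of : OffCellKernel :=
  offCellKernel_of_stubs stub_boundedVolumeNormalForm stub_classicalSymbolInjective
    stub_motivicVolumesAccessibleModCell

end Summit.KontsevichZagierPeriods.KontsevichZagierPeriods.Cruxes.OffCellKernel.Birth

end
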